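import Literature.NumberTheory.PAdicHodge.AinfEvalPtTruncation
import HarnessLib

/-!
# `(p, ξ)`-adic truncation of `evalPt` at NILPOTENT-MODULO-`(p, ξ)` points (deep division points)

Topic `Literature/NumberTheory/PAdicHodge`; namespace `Literature.NumberTheory.PAdicHodge.AinfTop`. THEOREMS ONLY (no definition, no named fact,
no instance, no `sorry`). Sequel of `AinfEvalPtTruncation` (which treats points with coordinates IN `(p, ξ)`): for a point `x` of the nil ideal
`𝔫 = θ⁻¹(𝔪_ℂ)` whose coordinates are only `(p, ξ)`-NILPOTENT — `(x i)^N ∈ (p, ξ)`, e.g. the canonical lift `ι[ũ⁽ⁿ⁾]` of a deep member of a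
`[p]`-division sequence (`θ = uₙ`, `‖uₙ‖ → 1`) — and an integral series `f ∈ ℤ⟦X₀, X₁⟧` without constant term:

* `sup_span_pow_le_of_pow_mem` — `(x₀, x₁)^{2N} ⊆ (p, ξ)` (Mathlib `Ideal.sup_pow_add_le_pow_sup_pow`);
* ★ `coe_evalPt_sub_aeval_truncTotal_mem_pow_div` — `evalPt 𝔫 f x − (truncTotal_{D+1} f)(x) ∈ (p, ξ)^{(D+1)/(2N)}`;
* ★ `coe_addW_sub_aeval_truncTotal_mem_pow_div` — the case `f = F_W`: `(a ⊕_W b) − (F_W)_{≤D}(a, b) ∈ (p, ξ)^{(D+1)/(2N)}`.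

This is the `p`-adic-value hypothesis (`hstep`/`hg`) of the additivity / iterated-addition theorems
`Literature.RingTheory.FormalGroups.PadicLogSeries.logSum_eq_add_of_forall_sub_aeval_mem` / `logSum_eq_nsmul_of_tower` for DEEP division points,
i.e. the `[p]`-compatibility input of `frobenius_honda_eq_zero_of_tower` (φ-road of line `kato_lever`, crux K★ `stmt-BirchSwinnertonDyer-22226`,
memo `Lines/kato-lever-K2-phi-road.md`). Infrastructure only; BSD / K★ are not proved by any of this.

## References
* J. W. S. Cassels, A. Fröhlich (eds.), *Algebraic Number Theory* (1967), Ch. VI §3.2. [CasselsFrohlichANT1967]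
* J.-M. Fontaine, *Le corps des périodes p-adiques*, Astérisque 223 (1994), Exp. II §1.3. [FontaineAsterisque223III]
-/

noncomputable section

open Ideal Filter Topology WittVector MvPowerSeries

namespace Literature.NumberTheory.PAdicHodge

namespace AinfTop

open Literature.NumberTheory.GaloisRepresentations Literature.NumberTheory.GaloisRepresentations.IsNonarchimedeanLocalField
open Literature.NumberTheory.GaloisRepresentations.LubinTate

variable {F : Type} [Field F] [ValuativeRel F] [TopologicalSpace F] [IsNonarchimedeanLocalField F]
  {p : ℕ} [Fact p.Prime] [Fact (¬ IsUnit (p : integerC F))]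
  [IsAdicComplete (Ideal.span {(p : integerC F)}) (integerC F)] [CharZero F]
  {hθ : Function.Surjective (fontaineTheta (integerC F) p)}

/-- **`(x₀, x₁)^{N+N} ⊆ J` when `x₀^N, x₁^N ∈ J`** (any commutative ring). [folklore] -/
private theorem sup_span_pow_le_of_pow_mem {R : Type*} [CommRing R] {J : Ideal R} {a b : R} {N : ℕ} (ha : a ^ N ∈ J) (hb : b ^ N ∈ J) :
    (Ideal.span {a} ⊔ Ideal.span {b}) ^ (N + N) ≤ J := by
  refine Ideal.sup_pow_add_le_pow_sup_pow.trans (sup_le ?_ ?_)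
  · rw [Ideal.span_singleton_pow, Ideal.span_singleton_le_iff_mem]; exact ha
  · rw [Ideal.span_singleton_pow, Ideal.span_singleton_le_iff_mem]; exact hb

/-- A monomial of degree `|d|` in `(x₀, x₁)` lies in `(x₀, x₁)^{|d|}`. [folklore] -/
private theorem prod_pow_mem_sup_pow {R : Type*} [CommRing R] (y : Fin 2 → R) (d : Fin 2 →₀ ℕ) :
    (d.prod fun i e => y i ^ e) ∈ (Ideal.span {y 0} ⊔ Ideal.span {y 1}) ^ d.degree := by
  have hy : ∀ i : Fin 2, y i ∈ Ideal.span {y 0} ⊔ Ideal.span {y 1} := by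
    intro i; fin_cases i
    · exact Ideal.mem_sup_left (Ideal.mem_span_singleton_self _)
    · exact Ideal.mem_sup_right (Ideal.mem_span_singleton_self _)
  rw [Finsupp.prod, Finsupp.degree_apply, ← Finset.prod_pow_eq_pow_sum]
  exact Ideal.prod_mem_prod fun i _ => Ideal.pow_mem_pow (hy i) _

/-- ★ **Truncations approximate point values at `(p, ξ)`-nilpotent points.** For `f ∈ ℤ⟦X₀,X₁⟧` without constant term and `x : Fin 2 → 𝔫` with
`(x i)^N ∈ (p, ξ)`: `evalPt 𝔫 f x − (truncTotal_{D+1} f)(x) ∈ (p, ξ)^{(D+1)/(N+N)}` — every monomial of degree `≥ D + 1` lies in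
`(x₀,x₁)^{D+1} ⊆ ((x₀,x₁)^{2N})^{(D+1)/(2N)} ⊆ (p,ξ)^{(D+1)/(2N)}`, a closed ideal. [cite: CasselsFrohlichANT1967, Ch. VI §3.2]
[cite: FontaineAsterisque223III, Exp. II §1.3] -/
theorem coe_evalPt_sub_aeval_truncTotal_mem_pow_div (f : MvPowerSeries (Fin 2) ℤ) (hf : f.constantCoeff = 0)
    (x : Fin 2 → (nilTheta F p hθ).toIdeal) {N : ℕ} (hx : ∀ i, (x i : AinfTop F p) ^ N ∈ (WithIdeal.i : Ideal (AinfTop F p))) (D : ℕ) :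
    ((evalPt (nilTheta F p hθ) f hf x : (nilTheta F p hθ).toIdeal) : AinfTop F p) -
        MvPolynomial.aeval (fun i => (x i : AinfTop F p)) (truncTotal (D + 1) f) ∈
      (WithIdeal.i : Ideal (AinfTop F p)) ^ ((D + 1) / (N + N)) := by
  classical
  have hev := (nilTheta F p hθ).hasEval x
  set g : MvPowerSeries (Fin 2) ℤ := f - ((truncTotal (D + 1) f : MvPolynomial (Fin 2) ℤ) : MvPowerSeries (Fin 2) ℤ) with hg
  have hsplit : ((evalPt (nilTheta F p hθ) f hf x : (nilTheta F p hθ).toIdeal) : AinfTop F p) -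
      MvPolynomial.aeval (fun i => (x i : AinfTop F p)) (truncTotal (D + 1) f) = MvPowerSeries.aeval hev g := by
    rw [coe_evalPt, hg, map_sub, MvPowerSeries.aeval_coe]
  rw [hsplit]
  set q := (D + 1) / (N + N) with hq
  have hJ : (Ideal.span {(x 0 : AinfTop F p)} ⊔ Ideal.span {(x 1 : AinfTop F p)}) ^ (N + N) ≤ (WithIdeal.i : Ideal (AinfTop F p)) :=
    sup_span_pow_le_of_pow_mem (hx 0) (hx 1)
  have hterm : ∀ d : Fin 2 →₀ ℕ, MvPowerSeries.coeff d g • (d.prod fun i e => (x i : AinfTop F p) ^ e) ∈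
      (WithIdeal.i : Ideal (AinfTop F p)) ^ q := by
    intro d
    by_cases hd : d.degree < D + 1
    · have h0 : MvPowerSeries.coeff d g = 0 := by
        rw [hg, map_sub, MvPolynomial.coeff_coe, MvPowerSeries.coeff_truncTotal _ hd, sub_self]
      rw [h0, zero_smul]
      exact Submodule.zero_mem _
    · refine Submodule.smul_of_tower_mem _ _ ?_
      have h1 := prod_pow_mem_sup_pow (fun i => (x i : AinfTop F p)) d
      have hle : (Ideal.span {(x 0 : AinfTop F p)} ⊔ Ideal.span {(x 1 : AinfTop F p)}) ^ d.degree ≤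
          (WithIdeal.i : Ideal (AinfTop F p)) ^ q := by
        refine (Ideal.pow_le_pow_right (show (N + N) * q ≤ d.degree from ?_)).trans ?_
        · have := Nat.div_mul_le_self (D + 1) (N + N); rw [hq]; nlinarith [Nat.div_mul_le_self (D + 1) (N + N)]
        · rw [pow_mul]; exact Ideal.pow_right_mono hJ q
      exact hle h1
  refine (isClosed_ideal_pow (F := F) (p := p) q).mem_of_tendsto (MvPowerSeries.hasSum_aeval hev g)
    (Filter.Eventually.of_forall fun T => ?_)
  exact Ideal.sum_mem _ fun d _ => hterm d

/-- ★ **The chord–tangent sum at `(p, ξ)`-nilpotent points is approximated by its truncations**: for `a, b ∈ Ŵ(𝔫)` with `a^N, b^N ∈ (p, ξ)`,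
`(a ⊕_W b) − (F_W)_{≤D}(a, b) ∈ (p, ξ)^{(D+1)/(2N)}` — the hypothesis `hstep` of `PadicLogSeries.logSum_eq_nsmul_of_tower` along the iterates
`k • [ũ]` of a deep division point. [cite: CasselsFrohlichANT1967, Ch. VI §3.2] -/
theorem coe_addW_sub_aeval_truncTotal_mem_pow_div (W : WeierstrassCurve ℤ) (a b : (nilTheta F p hθ).toIdeal) {N : ℕ}
    (ha : ((a : AinfTop F p)) ^ N ∈ (WithIdeal.i : Ideal (AinfTop F p))) (hb : ((b : AinfTop F p)) ^ N ∈ (WithIdeal.i : Ideal (AinfTop F p)))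
    (D : ℕ) :
    ((addW W a b : (nilTheta F p hθ).toIdeal) : AinfTop F p) -
        MvPolynomial.aeval (fun i => ((![a, b] : Fin 2 → (nilTheta F p hθ).toIdeal) i : AinfTop F p)) (truncTotal (D + 1) W.formalGroupLaw) ∈
      (WithIdeal.i : Ideal (AinfTop F p)) ^ ((D + 1) / (N + N)) :=
  coe_evalPt_sub_aeval_truncTotal_mem_pow_div W.formalGroupLaw W.constantCoeff_formalGroupLaw ![a, b]
    (fun i => by fin_cases i <;> assumption) D

end AinfTop

end Literature.NumberTheory.PAdicHodge

end
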